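import Literature.NumberTheory.EllipticCurves.KubertTwoTenProofs
import HarnessLib

/-!
# The rational points of `X₁(14)`: the curve `y² = x³ - 11x² + 32x` (`14A4`) has rank `0`
# and exactly six rational points

Topic `NumberTheory/EllipticCurves`; sibling of `KubertTwoTenProofs.lean` (the same method for
`X₁(2,10) = 20A`) and the arithmetic half of "no elliptic curve over `ℚ` has a rational point of
order `14`" (the case `m = 14` of Mazur's Thm. (7'), one of the eleven composite orders of the
"First reduction", Mazur 1977, Ch. III §5, p. 156, after Kubert 1976, Ch. IV; the modular curve
`X₁(14)` is the elliptic curve `14A4 : y² + xy + y = x³ - x` of rank `0` with six rational points,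
its six rational cusps — Sutherland 2012, Table "genus 1 cases": `X₁(14) : y² = x³ - 675x + 13662`).
Everything is a theorem; no named fact and no definition is introduced.

We use the model with the rational `2`-torsion point at the origin,

  `V : y² = x³ - 11x² + 32x = x(x² - 11x + 32)`     (`⟨0, -11, 0, 32, 0⟩ : WeierstrassCurve ℚ`),

obtained from `14A4` by `x = 4ξ + 4`, `y = 8η + 4ξ + 4` (and from Sutherland's short model by
`x_S = 9x - 33`, `y_S = 27y`); `Δ(V) = 16·32²·(11² - 4·32) = -114688 = -2¹⁴·7`. The main theorem is

* `X1Fourteen_points` : every rational solution of `y² = x³ - 11x² + 32x` has `x ∈ {0, 4, 8}`,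

i.e. `V(ℚ) = {O, (0,0), (4,±4), (8,±8)} ≅ ℤ/6` (Cremona, *Algorithms*, Table 1, class `14A`:
`r = 0`, `|T| = 6`). The consumer is `KubertTateFourteen.lean`/its proofs file, which maps a
rational point of order `14` on any elliptic curve over `ℚ` to a rational point of `V` with
`x ∉ {0, 4, 8}`.

## Proof (descent via `2`-isogeny, then torsion), as in `KubertTwoTenProofs.lean`

1. **Rank `0`** (`finite_point_X1Fourteen`; `TwoIsogenyDescent.lean`, Silverman–Tate III.5–6,
   *AEC* X.4.9): `a = -11`, `b = 32`, isogenous curve `Y² = X³ + 22X² - 7X` (`b' = a² - 4b = -7`).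
   On `V` every affine `x ≠ 0` is `> 0` (`x² - 11x + 32 > 0`) with `v_p(x)` even for `p ≠ 2`
   (`even_padicValRat_of_twoTorsionNF`, `p ∤ b = 32`), so `x` or `2x` (hence `32x`) is a square:
   `α(V(ℚ)) ⊆ {[1], [2] = [32]}`. On the isogenous curve `v_p(X)` is even for `p ≠ 7`; if `X > 0`
   and `v₇(X)` is even, `X` is a square; if `X < 0` and `v₇(X)` is odd, `-7X` is a square; the two
   remaining cases are impossible: `X = -w²` gives `(Y/w)² = -w⁴ + 22w² + 7`, which has no rational
   solution (`Rat.torsor_neg_one_false`: in lowest terms `N² = -M⁴ + 22M²e² + 7e⁴` is `≡ 12 mod 16`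
   or `≡ 3 mod 4`), and `7X = w²` is carried to the previous case by translation by `T' = (0,0)`,
   `X ↦ -7/X = -(7/w)²`. So `α' ⊆ {[1], [-7]}`, `V(ℚ) = 2V(ℚ) + {O, T}`, and `V(ℚ)` is finite by
   the tree's Mordell–Weil theorem.
2. **Torsion**: `T = (0,0)` is the only rational `2`-torsion point (`4(x² - 11x + 32) =
   (2x - 11)² + 7 > 0`) and `2Q ≠ T` for all `Q` (duplication formula `x(2Q)(2y)² = (x² - 32)²`,
   `32` is not a rational square), so `2Q` has odd order for every `Q`; an odd-order point
   `P₀ = (x₀, y₀)` has `p`-integral `x₀` at every prime (prime-to-`p` torsion is `p`-integral,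
   *AEC* VII.3.1; `E₁(ℚ_p) ∩ E(ℚ)` is torsion-free for odd `p`, *AEC* VII.3.4 — the tree's
   `not_isOfFinAddOrder_of_one_lt_padicNorm_of_isIntegral`), `x₀ = w²` by the duplication formula,
   `w ∈ ℤ`, `v = y₀/w ∈ ℤ` with `v² = w⁴ - 11w² + 32`, forcing `w² = 4`
   (`Int.sq_eq_four_of_sq_eq`: `(w² - 6)² < v² < (w² - 5)²` once `w² ≥ 8`).
3. Every point is `2Q` or `2Q + T`, whence `x ∈ {4} ∪ {0, 32/4 = 8}` (`X1Fourteen_points`).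

## References

* [Kubert1976] D. S. Kubert, *Universal bounds on the torsion of elliptic curves*, Proc. London
  Math. Soc. (3) 33 (1976) 193–237, Ch. IV (rational points of `X₁(N)` for small composite `N`).
* [Mazur1977] B. Mazur, *Modular curves and the Eisenstein ideal*, Publ. Math. IHÉS 47 (1977),
  Ch. III §5, p. 156 (First reduction: the composite orders, after Kubert).
* [Sutherland2012] A. V. Sutherland, *Constructing elliptic curves over finite fields with
  prescribed torsion*, Math. Comp. 81 (2012) 1131–1147, §4 Table "Short Weierstrass models for
  the genus 1 cases", `N = 14`: `y² = x³ - 675x + 13662` (= `14A4`).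
* [SilvermanAEC2009] J. H. Silverman, *The Arithmetic of Elliptic Curves*, 2nd ed.: III.2.3(d),
  VII.3.1, VII.3.4, VIII.6.7, X.4.9.
* J. H. Silverman, J. Tate, *Rational Points on Elliptic Curves* (1992), III.5–III.6 (not held).
* [CremonaAlgorithms1997] J. E. Cremona, *Algorithms for Modular Elliptic Curves*, Table 1,
  `N = 14` (consistency check only; not used in proofs).

## Design

Verbatim the design of `KubertTwoTenProofs.lean`: the curve is the literal `⟨0, -11, 0, 32, 0⟩`
(written out at each occurrence; no abbreviation is declared), its `ℚ`-points carry Mathlib's group law with `ℚ`'s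
decidable equality, and the generic descent/torsion files (classical instance) are bridged by the
tree's `point_add_irrel` / `point_zsmul_irrel`. `IsElliptic`, `IsIntegral ℤ` are supplied by
`haveI`. The `2`-adic local insolubility is reduced to three finite statements over `ZMod 16` /
`ZMod 4` checked by `decide`.
-/

noncomputable section

open scoped Classical NNReal

namespace Literature.NumberTheory.EllipticCurves

open _root_.WeierstrassCurve KramerTwoDescent

/-! ### The curve `V : y² = x³ - 11x² + 32x` -/

/-- `Δ(V) = -114688 = -2¹⁴ · 7`. [folklore] -/
theorem X1Fourteen_Δ : (⟨0, -11, 0, 32, 0⟩ : WeierstrassCurve ℚ).Δ = -114688 := by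
  norm_num [WeierstrassCurve.Δ, b₂, b₄, b₆, b₈]

/-- `V` is an elliptic curve (`Δ ≠ 0`). [folklore] -/
theorem isElliptic_X1Fourteen : (⟨0, -11, 0, 32, 0⟩ : WeierstrassCurve ℚ).IsElliptic := ⟨by rw [X1Fourteen_Δ]; norm_num⟩

/-- The model has integer coefficients. [folklore] -/
theorem isIntegral_X1Fourteen : (⟨0, -11, 0, 32, 0⟩ : WeierstrassCurve ℚ).IsIntegral ℤ :=
  ⟨⟨⟨0, -11, 0, 32, 0⟩, by ext <;> simp [baseChange, map]⟩⟩

/-- The affine equation of `V`: `y² = x³ - 11x² + 32x`. [folklore] -/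
theorem equation_X1Fourteen_iff (x y : ℚ) :
    (⟨0, -11, 0, 32, 0⟩ : WeierstrassCurve ℚ).toAffine.Equation x y ↔ y ^ 2 = x ^ 3 - 11 * x ^ 2 + 32 * x := by
  rw [Affine.equation_iff]
  constructor <;> intro h <;> linear_combination h

/-- `T = (0, 0)` is a nonsingular point of `V` (`a₆ = 0`, `a₄ = 32 ≠ 0`). [folklore] -/
theorem X1Fourteen_nonsingular_zero : (⟨0, -11, 0, 32, 0⟩ : WeierstrassCurve ℚ).toAffine.Nonsingular 0 0 := by
  rw [Affine.nonsingular_zero]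
  norm_num

/-- A prime `p` with `(p : ℤ) ∣ 32` is `2`. [folklore] -/
theorem eq_two_of_dvd_thirtytwo {p : ℕ} (hp : p.Prime) (hd : (p : ℤ) ∣ 32) : p = 2 := by
  have h : p ∣ 2 ^ 5 := by exact_mod_cast hd
  exact (Nat.prime_dvd_prime_iff_eq hp Nat.prime_two).mp (hp.dvd_of_dvd_pow h)

/-- A prime `p` with `(p : ℤ) ∣ -7` is `7`. [folklore] -/
theorem eq_seven_of_dvd {p : ℕ} (hp : p.Prime) (hd : (p : ℤ) ∣ -7) : p = 7 := by
  have h7 : p ∣ 7 := by exact_mod_cast (dvd_neg.mp hd)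
  exact (Nat.prime_dvd_prime_iff_eq hp (by decide)).mp h7

/-- `7` is prime (as a `Fact`, for the `padicValRat 7` lemmas). [folklore] -/
theorem fact_prime_seven : Fact (Nat.Prime 7) := ⟨by decide⟩

/-! ### `2`-adic insolubility of the torsor `N² = -M⁴ + 22M²e² + 7e⁴` -/

/-- Squares mod `16` are never `12`. [folklore] -/
theorem ZMod.sq_ne_twelve_sixteen : ∀ n : ZMod 16, n ^ 2 ≠ 12 := by decide

/-- For odd `m = 2k + 1`, `e = 2l + 1`: `-m⁴ + 22m²e² + 7e⁴ ≡ 12 (mod 16)`. [folklore] -/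
theorem ZMod.torsor_odd_odd_sixteen :
    ∀ k l : ZMod 16, -(2 * k + 1) ^ 4 + 22 * (2 * k + 1) ^ 2 * (2 * l + 1) ^ 2
      + 7 * (2 * l + 1) ^ 4 = 12 := by
  decide

/-- For `m = k + k` even, `e = 2l + 1` odd: `-m⁴ + 22m²e² + 7e⁴ ≡ 3 (mod 4)` is not a square.
[folklore] -/
theorem ZMod.torsor_even_odd_four :
    ∀ k l n : ZMod 4, n ^ 2 ≠ -(k + k) ^ 4 + 22 * (k + k) ^ 2 * (2 * l + 1) ^ 2
      + 7 * (2 * l + 1) ^ 4 := by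
  decide

/-- For `m = 2k + 1` odd, `e = l + l` even: `-m⁴ + 22m²e² + 7e⁴ ≡ 3 (mod 4)` is not a square.
[folklore] -/
theorem ZMod.torsor_odd_even_four :
    ∀ k l n : ZMod 4, n ^ 2 ≠ -(2 * k + 1) ^ 4 + 22 * (2 * k + 1) ^ 2 * (l + l) ^ 2
      + 7 * (l + l) ^ 4 := by
  decide

/-- **The torsor `N² = -M⁴ + 22M²e² + 7e⁴` has no integer point with `M`, `e` not both even**:
`2`-adically, `(M, e)` odd–odd gives `N² ≡ 12 (mod 16)`, and mixed parity gives
`N² ≡ 3 (mod 4)`. This is the local computation `[-1] ∉ α'(E'(ℚ))` of the descent via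
`2`-isogeny for `y² = x³ - 11x² + 32x` (Silverman–Tate III.6: the equations
`N² = b₁M⁴ + a'M²e² + b₂e⁴`, `b₁b₂ = b' = -7`, here `b₁ = -1`). [folklore] -/
theorem Int.torsor_neg_one_false {M e N : ℤ} (hcop : ¬ (2 ∣ M ∧ 2 ∣ e))
    (h : N ^ 2 = -M ^ 4 + 22 * M ^ 2 * e ^ 2 + 7 * e ^ 4) : False := by
  rcases Int.even_or_odd M with ⟨k, hk⟩ | ⟨k, hk⟩ <;>
    rcases Int.even_or_odd e with ⟨l, hl⟩ | ⟨l, hl⟩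
  · exact hcop ⟨⟨k, by rw [hk]; ring⟩, ⟨l, by rw [hl]; ring⟩⟩
  · subst hk hl
    have h4 := congrArg (Int.cast : ℤ → ZMod 4) h
    push_cast at h4
    exact ZMod.torsor_even_odd_four _ _ _ h4
  · subst hk hl
    have h4 := congrArg (Int.cast : ℤ → ZMod 4) h
    push_cast at h4
    exact ZMod.torsor_odd_even_four _ _ _ h4
  · subst hk hl
    have h16 := congrArg (Int.cast : ℤ → ZMod 16) h
    push_cast at h16
    rw [ZMod.torsor_odd_odd_sixteen] at h16
    exact ZMod.sq_ne_twelve_sixteen _ h16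

/-- **`z² = -w⁴ + 22w² + 7` has no rational solution.** Write `w = M/e` in lowest terms; then
`N = z e²` is an integer (a rational whose square is an integer) with
`N² = -M⁴ + 22M²e² + 7e⁴`, contradicting `Int.torsor_neg_one_false`. [folklore] -/
theorem Rat.torsor_neg_one_false (w z : ℚ) (h : z ^ 2 = -w ^ 4 + 22 * w ^ 2 + 7) : False := by
  set M : ℤ := w.num with hM
  set e : ℕ := w.den with he
  have hw : w * e = M := Rat.mul_den_eq_num w
  have hK : (z * (e : ℚ) ^ 2) ^ 2 =
      ((-M ^ 4 + 22 * M ^ 2 * (e : ℤ) ^ 2 + 7 * (e : ℤ) ^ 4 : ℤ) : ℚ) := by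
    push_cast
    calc (z * (e : ℚ) ^ 2) ^ 2 = z ^ 2 * (e : ℚ) ^ 4 := by ring
      _ = (-w ^ 4 + 22 * w ^ 2 + 7) * (e : ℚ) ^ 4 := by rw [h]
      _ = -(w * e) ^ 4 + 22 * (w * e) ^ 2 * (e : ℚ) ^ 2 + 7 * (e : ℚ) ^ 4 := by ring
      _ = _ := by rw [hw]
  have hden : (z * (e : ℚ) ^ 2).den = 1 := Rat.den_eq_one_of_sq_eq_intCast hK
  have hNQ : (((z * (e : ℚ) ^ 2).num : ℤ) : ℚ) = z * (e : ℚ) ^ 2 :=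
    Rat.coe_int_num_of_den_eq_one hden
  set N : ℤ := (z * (e : ℚ) ^ 2).num with hN
  have hZ : N ^ 2 = -M ^ 4 + 22 * M ^ 2 * (e : ℤ) ^ 2 + 7 * (e : ℤ) ^ 4 := by
    have : ((N : ℤ) : ℚ) ^ 2 =
        ((-M ^ 4 + 22 * M ^ 2 * (e : ℤ) ^ 2 + 7 * (e : ℤ) ^ 4 : ℤ) : ℚ) := by
      rw [hNQ, hK]
    exact_mod_cast this
  refine Int.torsor_neg_one_false (M := M) (e := (e : ℤ)) (N := N) ?_ hZ
  rintro ⟨h2M, h2e⟩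
  have hcop : M.natAbs.Coprime e := w.reduced
  have h1 : (2 : ℕ) ∣ M.natAbs := Int.ofNat_dvd_left.mp h2M
  have h2 : (2 : ℕ) ∣ e := by exact_mod_cast h2e
  exact absurd (Nat.eq_one_of_dvd_coprimes hcop h1 h2) (by norm_num)

/-- **The integer points of `v² = w⁴ - 11w² + 32` have `w² = 4`**: for `w² ≥ 8`,
`(w² - 6)² < w⁴ - 11w² + 32 < (w² - 5)²`; `w² ∈ {0, 1}` give the non-squares `32`, `22`.
[folklore] -/
theorem Int.sq_eq_four_of_sq_eq {k j : ℤ} (h : j ^ 2 = (k ^ 2) ^ 2 - 11 * k ^ 2 + 32) :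
    k ^ 2 = 4 := by
  by_cases hk : 8 ≤ k ^ 2
  · exfalso
    set u := k ^ 2 - 6 with hu
    have hlow : u ^ 2 < j ^ 2 := by nlinarith
    have hup : j ^ 2 < (u + 1) ^ 2 := by nlinarith
    have h3 : |u| < |j| := sq_lt_sq.mp hlow
    have h4 : |j| < |u + 1| := sq_lt_sq.mp hup
    rw [abs_of_nonneg (by omega : (0 : ℤ) ≤ u)] at h3
    rw [abs_of_nonneg (by omega : (0 : ℤ) ≤ u + 1)] at h4
    omega
  · have hk2 : k ≤ 2 := by nlinarith
    have hk2' : -2 ≤ k := by nlinarith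
    have hj : j ≤ 6 := by nlinarith
    have hj' : -6 ≤ j := by nlinarith
    interval_cases k <;> interval_cases j <;> omega

/-! ### The descent hypotheses for `V` and its `2`-isogenous curve -/

/-- **`α(V(ℚ)) ⊆ {[1], [32]}`**: on `y² = x³ - 11x² + 32x` (`b = 32`), every rational point with
`x ≠ 0` has `x > 0` (`x(x² - 11x + 32) = y²`, `4(x² - 11x + 32) = (2x - 11)² + 7 > 0`) and
`v_p(x)` even for `p ≠ 2` (`p ∤ b`), so `x` or `2x` is a rational square according to the parity
of `v₂(x)`; in the second case `32x = (4w)²`. (The local computation of the descent: only signs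
and the prime `2 ∣ b` enter.) [folklore] -/
theorem X1Fourteen_sq_or_mul_sq {x y : ℚ} (h : (⟨0, -11, 0, 32, 0⟩ : WeierstrassCurve ℚ).toAffine.Nonsingular x y) (hx : x ≠ 0) :
    ∃ w : ℚ, x = w ^ 2 ∨ (⟨0, -11, 0, 32, 0⟩ : WeierstrassCurve ℚ).a₄ * x = w ^ 2 := by
  have he : y ^ 2 = x ^ 3 + ((-11 : ℤ) : ℚ) * x ^ 2 + ((32 : ℤ) : ℚ) * x := by
    have := (equation_X1Fourteen_iff x y).mp h.1
    push_cast; linear_combination this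
  -- positivity
  have hpos : 0 < x := by
    have hq : 0 < (2 * x - 11) ^ 2 + 7 := by positivity
    have hprod : x * ((2 * x - 11) ^ 2 + 7) = 4 * y ^ 2 := by
      push_cast at he; linear_combination -4 * he
    by_contra hle
    have hlt : x < 0 := lt_of_le_of_ne (not_lt.mp hle) hx
    nlinarith [sq_nonneg y, mul_neg_of_neg_of_pos hlt hq]
  -- parities away from `2`
  have heven : ∀ p : ℕ, p.Prime → p ≠ 2 → Even (padicValRat p x) := fun p hp hp2 => by
    haveI : Fact p.Prime := ⟨hp⟩
    exact even_padicValRat_of_twoTorsionNF he hx fun hd => hp2 (eq_two_of_dvd_thirtytwo hp hd)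
  have hcoef : (⟨0, -11, 0, 32, 0⟩ : WeierstrassCurve ℚ).a₄ = 32 := rfl
  rw [hcoef]
  by_cases h2 : Even (padicValRat 2 x)
  · obtain ⟨r, hr⟩ := exists_sq_of_even_padicValRat hpos fun p hp => by
      by_cases hp2 : p = 2
      · subst hp2; exact h2
      · exact heven p hp hp2
    exact ⟨r, Or.inl hr⟩
  · obtain ⟨r, hr⟩ := exists_sq_of_even_padicValRat (mul_pos (by norm_num : (0:ℚ) < 2) hpos)
      fun p hp => by
        haveI : Fact p.Prime := ⟨hp⟩
        rw [padicValRat.mul (by norm_num) hx]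
        by_cases hp2 : p = 2
        · subst hp2
          rw [show (2 : ℚ) = ((2 : ℕ) : ℚ) by norm_num, padicValRat.self (by norm_num)]
          rcases Int.even_or_odd (padicValRat 2 x) with h' | h'
          · exact absurd h' h2
          · obtain ⟨k, hk⟩ := h'
            exact ⟨k + 1, by omega⟩
        · have h20 : padicValRat p (2 : ℚ) = 0 := by
            rw [show (2 : ℚ) = ((2 : ℤ) : ℚ) by norm_num]
            refine padicValRat_intCast_eq_zero fun hd => hp2 ?_
            have h22 : p ∣ 2 := by exact_mod_cast hd
            exact (Nat.prime_dvd_prime_iff_eq hp Nat.prime_two).mp h22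
          rw [h20, zero_add]
          exact heven p hp hp2
    exact ⟨4 * r, Or.inr (by linear_combination 16 * hr)⟩

/-- **`[-1] ∉ α'(E'(ℚ))`**: no rational point `(X, Y)` of the isogenous curve
`E' : Y² = X³ + 22X² - 7X` has `-X` a nonzero square (`X = -w²` gives
`(Y/w)² = -w⁴ + 22w² + 7`, `Rat.torsor_neg_one_false`). [folklore] -/
theorem X1Fourteen_codomain_neg_ne_sq {X Y w : ℚ} (he : Y ^ 2 = X ^ 3 + 22 * X ^ 2 - 7 * X)
    (hw : w ≠ 0) (hX : X = -w ^ 2) : False := by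
  refine Rat.torsor_neg_one_false w (Y / w) ?_
  rw [div_pow, div_eq_iff (pow_ne_zero 2 hw)]
  rw [hX] at he
  linear_combination he

/-- **`α'(E'(ℚ)) ⊆ {[1], [-7]}`** for the `2`-isogenous curve `E' : Y² = X³ + 22X² - 7X` of `V`
(`a' = 22`, `b' = a² - 4b = -7`): every rational point with `X ≠ 0` has `X` or `-7X` a rational
square. Indeed `v_p(X)` is even for `p ≠ 7`; if `X > 0` with `v₇(X)` even then `X` is a square,
if `X < 0` with `v₇(X)` odd then `-7X` is a square; `X < 0` with `v₇(X)` even would make `-X` a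
square (`X1Fourteen_codomain_neg_ne_sq`), and `X > 0` with `v₇(X)` odd would make `7X = w²` a
square, so that the translate `T' + (X, Y) = (-7/X, 7Y/X²)` has abscissa `-(7/w)²`, again
excluded. [folklore] -/
theorem X1Fourteen_codomain_sq_or_neg_seven_mul_sq {X Y : ℚ}
    (h : (⟨0, -11, 0, 32, 0⟩ : WeierstrassCurve ℚ).twoIsogenyCodomain.toAffine.Nonsingular X Y) (hX : X ≠ 0) :
    ∃ w : ℚ, X = w ^ 2 ∨ ((⟨0, -11, 0, 32, 0⟩ : WeierstrassCurve ℚ).a₂ ^ 2 - 4 * (⟨0, -11, 0, 32, 0⟩ : WeierstrassCurve ℚ).a₄) * X = w ^ 2 := by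
  haveI := fact_prime_seven
  have he : Y ^ 2 = X ^ 3 + ((22 : ℤ) : ℚ) * X ^ 2 + ((-7 : ℤ) : ℚ) * X := by
    have := WeierstrassCurve.rel_of_nonsingular (⟨0, -11, 0, 32, 0⟩ : WeierstrassCurve ℚ).twoIsogenyCodomain h
    simp only [twoIsogenyCodomain_a₂, twoIsogenyCodomain_a₄] at this
    push_cast; linear_combination this
  have he' : Y ^ 2 = X ^ 3 + 22 * X ^ 2 - 7 * X := by push_cast at he; linear_combination he
  -- parities away from `7`
  have heven : ∀ p : ℕ, p.Prime → p ≠ 7 → Even (padicValRat p X) := fun p hp hp7 => by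
    haveI : Fact p.Prime := ⟨hp⟩
    exact even_padicValRat_of_twoTorsionNF he hX fun hd => hp7 (eq_seven_of_dvd hp hd)
  have hcoef : (⟨0, -11, 0, 32, 0⟩ : WeierstrassCurve ℚ).a₂ ^ 2 - 4 * (⟨0, -11, 0, 32, 0⟩ : WeierstrassCurve ℚ).a₄ = -7 := by norm_num
  rw [hcoef]
  have h7Q : padicValRat 7 (7 : ℚ) = 1 := by
    rw [show (7 : ℚ) = ((7 : ℕ) : ℚ) by norm_num, padicValRat.self (by norm_num)]
  have h70 : ∀ p : ℕ, p.Prime → p ≠ 7 → padicValRat p (7 : ℚ) = 0 := fun p hp hp7 => by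
    haveI : Fact p.Prime := ⟨hp⟩
    rw [show (7 : ℚ) = ((7 : ℤ) : ℚ) by norm_num]
    refine padicValRat_intCast_eq_zero fun hd => hp7 ?_
    have h77 : p ∣ 7 := by exact_mod_cast hd
    exact (Nat.prime_dvd_prime_iff_eq hp (by decide)).mp h77
  -- all valuations of `X` are even, or all valuations of `7X` (equivalently `-7X`) are even
  have hval : (∀ p : ℕ, p.Prime → Even (padicValRat p X)) ∨
      (∀ p : ℕ, p.Prime → Even (padicValRat p (7 * X))) := by
    by_cases h7 : Even (padicValRat 7 X)
    · refine Or.inl fun p hp => ?_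
      by_cases hp7 : p = 7
      · subst hp7; exact h7
      · exact heven p hp hp7
    · refine Or.inr fun p hp => ?_
      haveI : Fact p.Prime := ⟨hp⟩
      rw [padicValRat.mul (by norm_num) hX]
      by_cases hp7 : p = 7
      · subst hp7
        rw [h7Q]
        rcases Int.even_or_odd (padicValRat 7 X) with h' | h'
        · exact absurd h' h7
        · obtain ⟨k, hk⟩ := h'
          exact ⟨k + 1, by omega⟩
      · rw [h70 p hp hp7, zero_add]
        exact heven p hp hp7
  rcases lt_or_gt_of_ne hX with hneg | hpos
  · -- `X < 0`
    rcases hval with hv | hv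
    · -- `-X` is a square: impossible
      exfalso
      obtain ⟨w, hw⟩ := exists_sq_of_even_padicValRat (neg_pos.mpr hneg) fun p hp => by
        haveI : Fact p.Prime := ⟨hp⟩
        rw [padicValRat.neg]; exact hv p hp
      have hw0 : w ≠ 0 := by rintro rfl; apply hX; linear_combination -hw
      exact X1Fourteen_codomain_neg_ne_sq he' hw0 (by linear_combination -hw)
    · -- `-7X` is a square
      obtain ⟨w, hw⟩ := exists_sq_of_even_padicValRat
        (show (0 : ℚ) < -7 * X by nlinarith) fun p hp => by
          haveI : Fact p.Prime := ⟨hp⟩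
          rw [show (-7 : ℚ) * X = -(7 * X) by ring, padicValRat.neg]; exact hv p hp
      exact ⟨w, Or.inr hw⟩
  · -- `X > 0`
    rcases hval with hv | hv
    · obtain ⟨w, hw⟩ := exists_sq_of_even_padicValRat hpos hv
      exact ⟨w, Or.inl hw⟩
    · -- `7X = w²`: translate by `T'` and reach the excluded case
      exfalso
      obtain ⟨w, hw⟩ := exists_sq_of_even_padicValRat (mul_pos (by norm_num) hpos) hv
      have hw0 : w ≠ 0 := by
        rintro rfl
        exact mul_ne_zero (by norm_num : (7 : ℚ) ≠ 0) hX (by rw [hw]; ring)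
      -- the translate `(X', Y') = (-7/X, 7Y/X²)` lies on `E'` and `X' = -(7/w)²`
      have heX : (7 * Y / X ^ 2) ^ 2 = (-7 / X) ^ 3 + 22 * (-7 / X) ^ 2 - 7 * (-7 / X) := by
        field_simp
        linear_combination he'
      refine X1Fourteen_codomain_neg_ne_sq heX (div_ne_zero (by norm_num) hw0 : (7 : ℚ) / w ≠ 0) ?_
      rw [div_pow, ← hw]
      field_simp

/-! ### `V(ℚ)` is finite (rank `0`) -/

/-- **`V(ℚ)` is finite**: descent via `2`-isogeny (`finite_point_of_twoIsogenyDescent`, with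
`α ⊆ {[1],[32]}`, `α' ⊆ {[1],[-7]}`) and the Mordell–Weil theorem. In Cremona's tables this is
"`14A`: `r = 0`". [folklore] -/
theorem finite_point_X1Fourteen : Finite (⟨0, -11, 0, 32, 0⟩ : WeierstrassCurve ℚ).toAffine.Point := by
  haveI := isElliptic_X1Fourteen
  exact finite_point_of_twoIsogenyDescent (⟨0, -11, 0, 32, 0⟩ : WeierstrassCurve ℚ) (fun h hx => X1Fourteen_sq_or_mul_sq h hx)
    (fun h hX => X1Fourteen_codomain_sq_or_neg_seven_mul_sq h hX)

/-! ### The group law on `V(ℚ)` in coordinates -/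

/-- `-(x, y) = (x, -y)` on `V` (`a₁ = a₃ = 0`). [folklore] -/
theorem X1Fourteen_negY (x y : ℚ) : (⟨0, -11, 0, 32, 0⟩ : WeierstrassCurve ℚ).toAffine.negY x y = -y := by
  rw [Affine.negY, toAffine_a₁, toAffine_a₃]; ring

/-- The curve equation from nonsingularity. [folklore] -/
theorem X1Fourteen_rel {x y : ℚ} (h : (⟨0, -11, 0, 32, 0⟩ : WeierstrassCurve ℚ).toAffine.Nonsingular x y) :
    y ^ 2 = x ^ 3 - 11 * x ^ 2 + 32 * x :=
  (equation_X1Fourteen_iff x y).mp h.1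

/-- `T + T = O` for `T = (0, 0)`. [folklore] -/
theorem X1Fourteen_T_add_T :
    (Affine.Point.some 0 0 X1Fourteen_nonsingular_zero : (⟨0, -11, 0, 32, 0⟩ : WeierstrassCurve ℚ).toAffine.Point) +
      (Affine.Point.some 0 0 X1Fourteen_nonsingular_zero : (⟨0, -11, 0, 32, 0⟩ : WeierstrassCurve ℚ).toAffine.Point) = 0 := by
  exact Affine.Point.add_self_of_Y_eq (by rw [X1Fourteen_negY, neg_zero])

/-- **The only rational `2`-torsion point of `V` is `T = (0, 0)`** (the other roots of
`x³ - 11x² + 32x` are `(11 ± √-7)/2`: `4(x² - 11x + 32) = (2x - 11)² + 7 > 0`). [folklore] -/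
theorem X1Fourteen_eq_T_of_add_self {P : (⟨0, -11, 0, 32, 0⟩ : WeierstrassCurve ℚ).toAffine.Point} (h2 : P + P = 0) (h0 : P ≠ 0) :
    P = (Affine.Point.some 0 0 X1Fourteen_nonsingular_zero : (⟨0, -11, 0, 32, 0⟩ : WeierstrassCurve ℚ).toAffine.Point) := by
  rcases P with _ | ⟨x, y, h⟩
  · exact absurd rfl h0
  have hy : y = (⟨0, -11, 0, 32, 0⟩ : WeierstrassCurve ℚ).toAffine.negY x y := by
    by_contra hy
    rw [Affine.Point.add_self_of_Y_ne hy] at h2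
    exact Affine.Point.some_ne_zero _ h2
  rw [X1Fourteen_negY] at hy
  have hy0 : y = 0 := by linarith
  have e := X1Fourteen_rel h
  rw [hy0] at e
  have hx : x * ((2 * x - 11) ^ 2 + 7) = 0 := by linear_combination -4 * e
  rcases mul_eq_zero.mp hx with hx0 | hx0
  · subst hx0 hy0; rfl
  · nlinarith [sq_nonneg (2 * x - 11)]

/-- **Duplication on `V`**: `x(2P) · (2y)² = (x² - 32)²` for `P = (x, y)` with `y ≠ 0`
(Silverman, *AEC*, III.2.3(d) with `a = -11`, `b = 32`). [folklore] -/
theorem X1Fourteen_addX_self_mul {x y : ℚ} (h : (⟨0, -11, 0, 32, 0⟩ : WeierstrassCurve ℚ).toAffine.Nonsingular x y)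
    (hy : y ≠ (⟨0, -11, 0, 32, 0⟩ : WeierstrassCurve ℚ).toAffine.negY x y) :
    (⟨0, -11, 0, 32, 0⟩ : WeierstrassCurve ℚ).toAffine.addX x x ((⟨0, -11, 0, 32, 0⟩ : WeierstrassCurve ℚ).toAffine.slope x x y y) * (2 * y) ^ 2 = (x ^ 2 - 32) ^ 2 := by
  have e := X1Fourteen_rel h
  have hy2 : y - (⟨0, -11, 0, 32, 0⟩ : WeierstrassCurve ℚ).toAffine.negY x y = 2 * y := by rw [X1Fourteen_negY]; ring
  have hℓ : (⟨0, -11, 0, 32, 0⟩ : WeierstrassCurve ℚ).toAffine.slope x x y y * (2 * y) = 3 * x ^ 2 - 22 * x + 32 := by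
    rw [Affine.slope_of_Y_ne rfl hy, hy2, toAffine_a₁, toAffine_a₂, toAffine_a₄,
      div_mul_cancel₀ _ (by rw [← hy2]; exact sub_ne_zero.mpr hy)]
    ring
  set ℓ := (⟨0, -11, 0, 32, 0⟩ : WeierstrassCurve ℚ).toAffine.slope x x y y
  rw [Affine.addX, toAffine_a₁, toAffine_a₂]
  linear_combination (2 * y * ℓ + (3 * x ^ 2 - 22 * x + 32)) * hℓ + 4 * (11 - 2 * x) * e

/-- `x² = 32` has no rational solution (`v₂(x²)` is even, `v₂(32) = 5`). [folklore] -/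
theorem Rat.sq_ne_thirtytwo (x : ℚ) : x ^ 2 ≠ 32 := by
  intro h
  have hx : x ≠ 0 := by rintro rfl; norm_num at h
  have hv := congrArg (padicValRat 2) h
  rw [padicValRat.pow, show (32 : ℚ) = ((2 : ℕ) : ℚ) ^ 5 by norm_num, padicValRat.pow,
    padicValRat.self (by norm_num)] at hv
  omega

/-- **No rational point `Q` with `2Q = T`** on `V` (`b = 32` is not a square: by the duplication
formula `x(2Q) = 0` would force `x² = 32`). This is "`T ∉ 2Γ`", i.e. no rational `4`-torsion
through `T`. [folklore] -/
theorem X1Fourteen_add_self_ne_T (Q : (⟨0, -11, 0, 32, 0⟩ : WeierstrassCurve ℚ).toAffine.Point) :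
    Q + Q ≠ (Affine.Point.some 0 0 X1Fourteen_nonsingular_zero : (⟨0, -11, 0, 32, 0⟩ : WeierstrassCurve ℚ).toAffine.Point) := by
  intro hQ
  rcases Q with _ | ⟨x, y, h⟩
  · rw [← Affine.Point.zero_def, add_zero] at hQ
    exact (Affine.Point.some_ne_zero _) hQ.symm
  by_cases hy : y = (⟨0, -11, 0, 32, 0⟩ : WeierstrassCurve ℚ).toAffine.negY x y
  · rw [Affine.Point.add_self_of_Y_eq hy] at hQ
    exact (Affine.Point.some_ne_zero _) hQ.symm
  · have key := X1Fourteen_addX_self_mul h hy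
    rw [Affine.Point.add_self_of_Y_ne hy, Affine.Point.some.injEq] at hQ
    rw [hQ.1, zero_mul] at key
    have : x ^ 2 - 32 = 0 := pow_eq_zero_iff two_ne_zero |>.mp key.symm
    exact Rat.sq_ne_thirtytwo x (by linear_combination this)

/-- `T + (x, y) = (32/x, -32y/x²)` for `x ≠ 0` (translation by the `2`-torsion point; `b = 32`).
[folklore] -/
theorem X1Fourteen_T_add_some {x y : ℚ} (h : (⟨0, -11, 0, 32, 0⟩ : WeierstrassCurve ℚ).toAffine.Nonsingular x y) (hx : x ≠ 0) :
    ∃ h', (Affine.Point.some 0 0 X1Fourteen_nonsingular_zero : (⟨0, -11, 0, 32, 0⟩ : WeierstrassCurve ℚ).toAffine.Point) +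
      .some x y h = .some (32 / x) (-32 * y / x ^ 2) h' := by
  have e := X1Fourteen_rel h
  have hx' : (0 : ℚ) ≠ x := fun h0 => hx h0.symm
  have hL : (0 - y) / (0 - x) = y / x := by rw [zero_sub, zero_sub, neg_div_neg_eq]
  rw [Affine.Point.add_of_X_ne hx']
  refine some_eq_some_of_eq _ ?_ ?_
  · rw [Affine.addX, Affine.slope_of_X_ne hx', hL, toAffine_a₁, toAffine_a₂]
    field_simp
    linear_combination e
  · rw [Affine.addY, X1Fourteen_negY, Affine.negAddY, Affine.addX, Affine.slope_of_X_ne hx', hL,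
      toAffine_a₁, toAffine_a₂]
    field_simp
    linear_combination -y * e

/-! ### The rational points of `V` -/

/-- **`V(ℚ) = 2·V(ℚ) + {O, T}`** with Mathlib's (decidable-equality–`ℚ`) group law: the descent
lemma `exists_eq_two_smul_or` specialised to `V` (the generic files use the classical instance;
the two group laws agree). [folklore] -/
theorem X1Fourteen_exists_eq_two_smul_or (P : (⟨0, -11, 0, 32, 0⟩ : WeierstrassCurve ℚ).toAffine.Point) :
    ∃ Q : (⟨0, -11, 0, 32, 0⟩ : WeierstrassCurve ℚ).toAffine.Point, P = Q + Q ∨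
      P = Q + Q + (Affine.Point.some 0 0 X1Fourteen_nonsingular_zero : (⟨0, -11, 0, 32, 0⟩ : WeierstrassCurve ℚ).toAffine.Point) := by
  haveI := isElliptic_X1Fourteen
  obtain ⟨Q, hQ⟩ := (⟨0, -11, 0, 32, 0⟩ : WeierstrassCurve ℚ).exists_eq_two_smul_or (fun h hx => X1Fourteen_sq_or_mul_sq h hx)
    (fun h hX => X1Fourteen_codomain_sq_or_neg_seven_mul_sq h hX) P
  refine ⟨Q, ?_⟩
  have h2 : ∀ (d : DecidableEq ℚ) (R : (⟨0, -11, 0, 32, 0⟩ : WeierstrassCurve ℚ).toAffine.Point),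
      (letI : DecidableEq ℚ := d; (2 • R :)) = @HAdd.hAdd _ _ _ (@instHAdd _
        (@WeierstrassCurve.Affine.Point.instAdd ℚ _ (⟨0, -11, 0, 32, 0⟩ : WeierstrassCurve ℚ).toAffine instDecidableEqRat)) R R := by
    intro d R
    have hd : d = instDecidableEqRat := Subsingleton.elim _ _
    subst hd
    exact two_nsmul R
  rw [h2 _ Q] at hQ
  rcases hQ with hQ | hQ
  · exact Or.inl hQ
  · rw [point_add_irrel (fun a b => Classical.propDecidable (a = b)) instDecidableEqRat] at hQ
    exact Or.inr hQ

/-- **Odd-order rational points of `V` have integral abscissa** (Nagell–Lutz style): for a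
rational point `P₀ = (x₀, y₀)` of odd order `m`, `‖x₀‖_p ≤ 1` at every prime `p` — at `p = 2`
because `m`-torsion with `‖m‖₂ = 1` is `2`-integral (`val_le_one_of_zsmul_eq_zero`, Silverman
*AEC* VII.3.1), at odd `p` because `E₁(ℚ_p) ∩ E(ℚ)` is torsion-free
(`not_isOfFinAddOrder_of_one_lt_padicNorm_of_isIntegral`, *AEC* VII.3.4). [folklore] -/
theorem X1Fourteen_norm_le_one_of_odd {x₀ y₀ : ℚ} {h₀ : (⟨0, -11, 0, 32, 0⟩ : WeierstrassCurve ℚ).toAffine.Nonsingular x₀ y₀}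
    (hfin : IsOfFinAddOrder (.some x₀ y₀ h₀ : (⟨0, -11, 0, 32, 0⟩ : WeierstrassCurve ℚ).toAffine.Point))
    (hodd : Odd (addOrderOf (.some x₀ y₀ h₀ : (⟨0, -11, 0, 32, 0⟩ : WeierstrassCurve ℚ).toAffine.Point)))
    (p : ℕ) [Fact p.Prime] : ‖(x₀ : ℚ_[p])‖ ≤ 1 := by
  haveI := isElliptic_X1Fourteen
  haveI := isIntegral_X1Fourteen
  by_cases hp2 : p = 2
  · subst hp2
    haveI : (⟨0, -11, 0, 32, 0⟩ : WeierstrassCurve ℚ).IsIntegral (ratAdicValuation 2).integer :=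
      (⟨0, -11, 0, 32, 0⟩ : WeierstrassCurve ℚ).isIntegral_integer_ratAdicValuation 2
    set m := addOrderOf (.some x₀ y₀ h₀ : (⟨0, -11, 0, 32, 0⟩ : WeierstrassCurve ℚ).toAffine.Point) with hm
    have hm0 : m • (.some x₀ y₀ h₀ : (⟨0, -11, 0, 32, 0⟩ : WeierstrassCurve ℚ).toAffine.Point) = 0 := addOrderOf_nsmul_eq_zero _
    have hmz : (m : ℤ) • (.some x₀ y₀ h₀ : (⟨0, -11, 0, 32, 0⟩ : WeierstrassCurve ℚ).toAffine.Point) = 0 := by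
      rw [natCast_zsmul]; exact hm0
    have hmz' := (point_zsmul_irrel (instDecidableEqRat)
      (fun a b => Classical.propDecidable (a = b)) (m : ℤ)
      (.some x₀ y₀ h₀ : (⟨0, -11, 0, 32, 0⟩ : WeierstrassCurve ℚ).toAffine.Point)).symm.trans hmz
    have hw : ratAdicValuation 2 (((m : ℕ) : ℤ) : ℚ) = 1 := by
      rw [ratAdicValuation_apply, ← NNReal.coe_eq_one, coe_nnnorm, Int.cast_natCast,
        Rat.cast_natCast, Padic.norm_natCast_eq_one_iff]
      exact Nat.coprime_two_left.mpr hodd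
    have := val_le_one_of_zsmul_eq_zero (V := (⟨0, -11, 0, 32, 0⟩ : WeierstrassCurve ℚ)) hw hmz'
    rw [ratAdicValuation_apply, ← NNReal.coe_le_coe, NNReal.coe_one, coe_nnnorm] at this
    exact this
  · have hp3 : 3 ≤ p := by
      have h2 := (Fact.out : p.Prime).two_le
      omega
    by_contra h1
    exact not_isOfFinAddOrder_of_one_lt_padicNorm_of_isIntegral (⟨0, -11, 0, 32, 0⟩ : WeierstrassCurve ℚ) p hp3 h₀
      (not_le.mp h1) hfin

/-- **In `V(ℚ)` the double of any point has odd order**: otherwise a suitable multiple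
`R = j·(2Q)` would have order `2`, so `R = T` (`X1Fourteen_eq_T_of_add_self`), i.e.
`T = 2(jQ)`, contradicting `X1Fourteen_add_self_ne_T`. [folklore] -/
theorem X1Fourteen_odd_addOrderOf_add_self [Finite (⟨0, -11, 0, 32, 0⟩ : WeierstrassCurve ℚ).toAffine.Point]
    (Q : (⟨0, -11, 0, 32, 0⟩ : WeierstrassCurve ℚ).toAffine.Point) : Odd (addOrderOf (Q + Q)) := by
  by_contra heven
  rw [Nat.not_odd_iff_even] at heven
  obtain ⟨j, hj⟩ := heven
  have hpos : 0 < addOrderOf (Q + Q) := (isOfFinAddOrder_of_finite _).addOrderOf_pos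
  have hj0 : j ≠ 0 := by rintro rfl; omega
  have hR : addOrderOf (j • (Q + Q)) = 2 := by
    rw [addOrderOf_nsmul' (Q + Q) hj0, hj, ← two_mul, Nat.gcd_mul_left_left,
      Nat.mul_div_cancel _ (Nat.pos_of_ne_zero hj0)]
  have hR0 : j • (Q + Q) ≠ 0 := by
    intro h0
    rw [h0, addOrderOf_zero] at hR
    exact absurd hR (by norm_num)
  have hR2 : j • (Q + Q) + j • (Q + Q) = 0 := by
    rw [← two_nsmul, ← hR]; exact addOrderOf_nsmul_eq_zero _
  have hT := X1Fourteen_eq_T_of_add_self hR2 hR0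
  rw [nsmul_add] at hT
  exact X1Fourteen_add_self_ne_T (j • Q) hT

/-- **The rational points of `X₁(14)`: `y² = x³ - 11x² + 32x` has only the solutions with
`x ∈ {0, 4, 8}`**, i.e. `V(ℚ) = {O, (0,0), (4,±4), (8,±8)} ≅ ℤ/6` consists of the six rational
cusps of `X₁(14)` (Cremona's Table 1, class `14A`: `r = 0`, `|T| = 6`; Kubert 1976, Ch. IV;
Sutherland 2012, Table of genus-`1` models, `N = 14`). Proof: `V(ℚ)` is finite
(`finite_point_X1Fourteen`: `2`-isogeny descent + Mordell–Weil); write a rational point as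
`P = 2Q` or `2Q + T` (`X1Fourteen_exists_eq_two_smul_or`); `P₀ = 2Q` has odd order, hence
integral abscissa `x₀` (`X1Fourteen_norm_le_one_of_odd`), and `x₀ = w²` by the duplication
formula, so `w ∈ ℤ`, `v = y₀/w ∈ ℤ` with `v² = w⁴ - 11w² + 32`, forcing `w² = 4`
(`Int.sq_eq_four_of_sq_eq`); thus `P₀ ∈ {O, (4, ±4)}` and `P ∈ P₀ + {O, T}` has
`x(P) ∈ {0, 4, 8}`. [cite: Kubert1976, Ch. IV (rational points of X₁(14)); Sutherland2012, §4 Table (genus 1 cases), N = 14] -/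
theorem X1Fourteen_points (x y : ℚ) (hxy : y ^ 2 = x ^ 3 - 11 * x ^ 2 + 32 * x) :
    x = 0 ∨ x = 4 ∨ x = 8 := by
  haveI := isElliptic_X1Fourteen
  haveI := finite_point_X1Fourteen
  have hfin : ∀ R : (⟨0, -11, 0, 32, 0⟩ : WeierstrassCurve ℚ).toAffine.Point, IsOfFinAddOrder R := fun R =>
    isOfFinAddOrder_of_finite R
  have hns : (⟨0, -11, 0, 32, 0⟩ : WeierstrassCurve ℚ).toAffine.Nonsingular x y :=
    Affine.equation_iff_nonsingular.mp ((equation_X1Fourteen_iff x y).mpr hxy)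
  obtain ⟨Q, hQ⟩ := X1Fourteen_exists_eq_two_smul_or (.some x y hns)
  obtain ⟨P₀, hP₀⟩ : ∃ P₀ : (⟨0, -11, 0, 32, 0⟩ : WeierstrassCurve ℚ).toAffine.Point, P₀ = Q + Q := ⟨_, rfl⟩
  rw [← hP₀] at hQ
  have hodd : Odd (addOrderOf P₀) := hP₀ ▸ X1Fourteen_odd_addOrderOf_add_self Q
  -- `P₀ = O` or `P₀ = (4, y₀)`
  have hcases : P₀ = 0 ∨ ∃ (y₀ : ℚ) (h₀ : (⟨0, -11, 0, 32, 0⟩ : WeierstrassCurve ℚ).toAffine.Nonsingular 4 y₀),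
      P₀ = .some 4 y₀ h₀ := by
    rcases hP : P₀ with _ | ⟨x₀, y₀, h₀⟩
    · exact Or.inl rfl
    right
    rw [hP] at hP₀ hodd
    -- `Q = (x₁, y₁)` with `y₁ ≠ 0`, and `x₀ = x(2Q)` is a square
    rcases Q with _ | ⟨x₁, y₁, h₁⟩
    · rw [← Affine.Point.zero_def, add_zero] at hP₀
      exact absurd hP₀ (Affine.Point.some_ne_zero _)
    by_cases hy₁ : y₁ = (⟨0, -11, 0, 32, 0⟩ : WeierstrassCurve ℚ).toAffine.negY x₁ y₁
    · rw [Affine.Point.add_self_of_Y_eq hy₁] at hP₀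
      exact absurd hP₀ (Affine.Point.some_ne_zero _)
    have key := X1Fourteen_addX_self_mul h₁ hy₁
    rw [Affine.Point.add_self_of_Y_ne hy₁, Affine.Point.some.injEq] at hP₀
    rw [← hP₀.1] at key
    have hy₁0 : y₁ ≠ 0 := by
      intro h0; apply hy₁; rw [X1Fourteen_negY, h0, neg_zero]
    obtain ⟨w, hw⟩ : ∃ w : ℚ, w = (x₁ ^ 2 - 32) / (2 * y₁) := ⟨_, rfl⟩
    have hsq : x₀ = w ^ 2 := by
      rw [hw, div_pow, eq_div_iff (pow_ne_zero 2 (mul_ne_zero two_ne_zero hy₁0))]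
      linear_combination key
    -- integrality of `x₀`, `w` and `v = y₀ / w`
    have hden : x₀.den = 1 :=
      Rat.den_eq_one_of_forall_norm_le_one fun p _ => X1Fourteen_norm_le_one_of_odd (hfin _) hodd p
    have hx₀Z : ((x₀.num : ℤ) : ℚ) = x₀ := Rat.coe_int_num_of_den_eq_one hden
    have hwden : w.den = 1 := Rat.den_eq_one_of_sq_eq_intCast (n := x₀.num) (by rw [hx₀Z, hsq])
    have hwZ : ((w.num : ℤ) : ℚ) = w := Rat.coe_int_num_of_den_eq_one hwden
    have e₀ := X1Fourteen_rel h₀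
    have hx₀0 : x₀ ≠ 0 := by
      rintro rfl
      have hy₀ : y₀ = 0 := by simpa using e₀
      subst hy₀
      apply X1Fourteen_add_self_ne_T (.some x₁ y₁ h₁)
      rw [Affine.Point.add_self_of_Y_ne hy₁]
      exact (some_eq_some_of_eq _ hP₀.1 hP₀.2).choose_spec ▸ rfl
    have hw0 : w ≠ 0 := by rintro rfl; exact hx₀0 (by rw [hsq]; ring)
    have hv : (y₀ / w) ^ 2 = x₀ ^ 2 - 11 * x₀ + 32 := by
      rw [div_pow, div_eq_iff (pow_ne_zero 2 hw0)]
      linear_combination e₀ + (x₀ ^ 2 - 11 * x₀ + 32) * hsq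
    have hvden : (y₀ / w).den = 1 :=
      Rat.den_eq_one_of_sq_eq_intCast (n := x₀.num ^ 2 - 11 * x₀.num + 32) (by
        rw [hv]; push_cast; rw [hx₀Z])
    have hvZ : (((y₀ / w).num : ℤ) : ℚ) = y₀ / w := Rat.coe_int_num_of_den_eq_one hvden
    -- the integer equation `v² = k⁴ - 11k² + 32`, `x₀ = k²`
    have hk : x₀ = ((w.num : ℤ) : ℚ) ^ 2 := by rw [hwZ, hsq]
    have hZ : ((y₀ / w).num : ℤ) ^ 2 = (w.num ^ 2) ^ 2 - 11 * w.num ^ 2 + 32 := by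
      have : ((((y₀ / w).num : ℤ) : ℚ)) ^ 2 = (((w.num : ℤ) : ℚ) ^ 2) ^ 2 -
          11 * ((w.num : ℤ) : ℚ) ^ 2 + 32 := by rw [hvZ, hv, hk]
      exact_mod_cast this
    have hk4 : w.num ^ 2 = 4 := Int.sq_eq_four_of_sq_eq hZ
    have hx₀4 : x₀ = 4 := by
      rw [hk]
      exact_mod_cast hk4
    subst hx₀4
    exact ⟨y₀, h₀, rfl⟩
  -- conclusion
  rcases hQ with hPQ | hPQ
  · rcases hcases with h0 | ⟨y₀, h₀, h1⟩
    · rw [h0] at hPQ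
      exact absurd hPQ (Affine.Point.some_ne_zero _)
    · rw [h1, Affine.Point.some.injEq] at hPQ
      exact Or.inr (Or.inl hPQ.1)
  · rcases hcases with h0 | ⟨y₀, h₀, h1⟩
    · rw [h0, zero_add, Affine.Point.some.injEq] at hPQ
      exact Or.inl hPQ.1
    · obtain ⟨h', e⟩ := X1Fourteen_T_add_some h₀ (by norm_num : (4 : ℚ) ≠ 0)
      rw [h1, add_comm, e, Affine.Point.some.injEq] at hPQ
      exact Or.inr (Or.inr (by rw [hPQ.1]; norm_num))

/-- **The six rational points are all there is, as a statement about affine points**: an affine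
rational point of `V` is one of `(0, 0)`, `(4, ±4)`, `(8, ±8)`. [cite: Sutherland2012, §4 Table (genus 1 cases), N = 14] -/
theorem X1Fourteen_points_eq (x y : ℚ) (hxy : y ^ 2 = x ^ 3 - 11 * x ^ 2 + 32 * x) :
    (x = 0 ∧ y = 0) ∨ (x = 4 ∧ (y = 4 ∨ y = -4)) ∨ (x = 8 ∧ (y = 8 ∨ y = -8)) := by
  rcases X1Fourteen_points x y hxy with rfl | rfl | rfl
  · left
    exact ⟨rfl, by nlinarith [sq_nonneg y]⟩
  · right; left
    refine ⟨rfl, ?_⟩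
    have h : (y - 4) * (y + 4) = 0 := by linear_combination hxy
    rcases mul_eq_zero.mp h with h | h
    · exact Or.inl (by linarith)
    · exact Or.inr (by linarith)
  · right; right
    refine ⟨rfl, ?_⟩
    have h : (y - 8) * (y + 8) = 0 := by linear_combination hxy
    rcases mul_eq_zero.mp h with h | h
    · exact Or.inl (by linarith)
    · exact Or.inr (by linarith)

end Literature.NumberTheory.EllipticCurves

end
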